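import Mathlib
import HarnessLib

/-!
# Item `LrcModEntire` (stmt-NavierStokesRegularity-20428), skeleton twist_split v6, CLASS road to `stub_twistingTHGerm` —
# the REGULARISED ABSOLUTE VALUE `√(u² + ε²)`: derivative formulas, bounds, and the operator identity behind the signed (Kato) Liouville theorem

Cell ns-regularity-ideate, seat ns-k2-port-2 g4 (kernel-port lineage; `--supports stmt-NavierStokesRegularity-20428 --as helper`; toolbox of
`…TwistingTHOscSignedLiouville`).  For a `C²` function `f` and `ε > 0`, `q := √(f² + ε²)` is `C²`, `q ≥ max(|f|, ε)`, `q ≤ |f| + ε`,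
`q′ = f f′/q`, `q″ = (f′² + f f″)/q − f²f′²/q³`, with `|q′| ≤ |f′|`, `|q″| ≤ 2f′²/ε + |f″|`; and — the point — for the similarity-variable
plane-oscillation operator `L = ∂_τ + ½∂_ξ((ξ+Ŝ)·) − ∂_ξξ` one has the exact identity
`[Q_ξξ + ½(1+Ŝ_ξ)ε²/Q] − [Q_τ + ½((1+Ŝ_ξ)Q + (ξ+Ŝ)Q_ξ)] = −(U·LU)/Q + ε²U_ξ²/Q³` for `Q = √(U²+ε²)` (`reg_operator_identity`, pure algebra),
so the SIGNED inequality `U·LU ≤ 0` makes `Q` a subsolution with forcing `½(1+Ŝ_ξ)ε²/Q ≤ ½|1+Ŝ_ξ|·ε` (`reg_forced_ineq`).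

* `reg_facts`, `reg_operator_identity`, `reg_forced_ineq` (real-number algebra);
* `hasDerivAt_reg`, `deriv_reg`, `hasDerivAt_deriv_reg`, `contDiff_reg` (calculus of `y ↦ √(f(y)² + ε²)`);
* `abs_reg_le`, `abs_deriv_reg_le`, `abs_mul_mul_inv_reg_le`, `abs_deriv_deriv_reg_le` (bounds).

WHAT THIS IS NOT: not a claim about Navier–Stokes regularity and not the stub (bears_on LADDER-NS N0, item 20428 / crux 19708; both OPEN) — calculus.
-/

noncomputable section

-- the summit and its single sub-problem share the name (CONVENTIONS §1), as in every Theorems file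
set_option linter.dupNamespace false

namespace Summit.NavierStokesRegularity.NavierStokesRegularity.Theorems.PoloidalWindowDoorLrcModEntireTwistingTHOscRegularisedAbs

open Set Filter Topology

/-! ### The regularised absolute value `√(u² + ε²)`: algebra -/

/-- Basic facts: `q := √(u²+ε²)` is positive, `q² = u² + ε²`, `|u| ≤ q`, `ε ≤ q`, `q ≤ |u| + ε` (`ε > 0`). -/
theorem reg_facts {u ε : ℝ} (hε : 0 < ε) :
    0 < Real.sqrt (u ^ 2 + ε ^ 2) ∧ Real.sqrt (u ^ 2 + ε ^ 2) ^ 2 = u ^ 2 + ε ^ 2 ∧ |u| ≤ Real.sqrt (u ^ 2 + ε ^ 2) ∧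
      ε ≤ Real.sqrt (u ^ 2 + ε ^ 2) ∧ Real.sqrt (u ^ 2 + ε ^ 2) ≤ |u| + ε := by
  have hpos : 0 < u ^ 2 + ε ^ 2 := by positivity
  have hq0 : 0 < Real.sqrt (u ^ 2 + ε ^ 2) := Real.sqrt_pos.2 hpos
  have hq2 : Real.sqrt (u ^ 2 + ε ^ 2) ^ 2 = u ^ 2 + ε ^ 2 := Real.sq_sqrt hpos.le
  refine ⟨hq0, hq2, Real.abs_le_sqrt (by nlinarith [sq_nonneg ε]), (Real.le_sqrt hε.le hpos.le).2 (by nlinarith [sq_nonneg u]), ?_⟩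
  have h : Real.sqrt (u ^ 2 + ε ^ 2) ^ 2 ≤ (|u| + ε) ^ 2 := by
    rw [hq2, add_sq, sq_abs]; nlinarith [abs_nonneg u]
  exact abs_le_of_sq_le_sq h (by positivity [abs_nonneg u]) |> fun h' => (le_abs_self _).trans h'

/-- **The operator identity of the regularisation** (pure algebra; `r = 1/q`, `q² = u² + ε²`): with the derivative formulas
`Q_τ = u·u_τ·r`, `Q_ξ = u·u_ξ·r`, `Q_ξξ = (u_ξ² + u·u_ξξ)·r − u²u_ξ²·r³` of `Q = √(U²+ε²)`,
`[Q_ξξ + ½(1+s₁)ε²r] − [Q_τ + ½((1+s₁)Q + (ξ+s)Q_ξ)] = −r·u·(u_τ + ½((1+s₁)u + (ξ+s)u_ξ) − u_ξξ) + ε²u_ξ²r³`. -/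
theorem reg_operator_identity {u ut u1 u2 s s1 ξ q ε r : ℝ} (he1 : q * r = 1) (he2 : q ^ 2 = u ^ 2 + ε ^ 2) :
    (((u1 ^ 2 + u * u2) * r - u ^ 2 * u1 ^ 2 * r ^ 3) + 1 / 2 * (1 + s1) * ε ^ 2 * r)
      - (u * ut * r + 1 / 2 * ((1 + s1) * q + (ξ + s) * (u * u1 * r)))
      = -(r * (u * (ut + 1 / 2 * ((1 + s1) * u + (ξ + s) * u1) - u2))) + ε ^ 2 * u1 ^ 2 * r ^ 3 := by
  linear_combination (-(u1 ^ 2) * r * (1 + q * r) + (1 + s1) / 2 * q) * he1 + (u1 ^ 2 * r ^ 3 - (1 + s1) / 2 * r) * he2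

/-- **The forced subsolution inequality of the regularisation**: the signed inequality `u·(signed operator) ≤ 0` implies
`Q_τ + ½((1+s₁)Q + (ξ+s)Q_ξ) ≤ Q_ξξ + ½(1+s₁)ε²/q` (derivative formulas as in `reg_operator_identity`, written with `q⁻¹`). -/
theorem reg_forced_ineq {u ut u1 u2 s s1 ξ q ε : ℝ} (hq : 0 < q) (hq2 : q ^ 2 = u ^ 2 + ε ^ 2)
    (hsgn : u * (ut + 1 / 2 * ((1 + s1) * u + (ξ + s) * u1) - u2) ≤ 0) :
    u * ut * q⁻¹ + 1 / 2 * ((1 + s1) * q + (ξ + s) * (u * u1 * q⁻¹)) ≤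
      ((u1 ^ 2 + u * u2) * q⁻¹ - u ^ 2 * u1 ^ 2 * q⁻¹ ^ 3) + 1 / 2 * (1 + s1) * ε ^ 2 * q⁻¹ := by
  have he1 : q * q⁻¹ = 1 := mul_inv_cancel₀ hq.ne'
  have hid := reg_operator_identity (u := u) (ut := ut) (u1 := u1) (u2 := u2) (s := s) (s1 := s1) (ξ := ξ) (ε := ε) he1 hq2
  have hr : 0 < q⁻¹ := inv_pos.2 hq
  have h1 : 0 ≤ -(q⁻¹ * (u * (ut + 1 / 2 * ((1 + s1) * u + (ξ + s) * u1) - u2))) := by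
    have := mul_nonpos_of_nonneg_of_nonpos hr.le hsgn
    linarith
  have h2 : 0 ≤ ε ^ 2 * u1 ^ 2 * q⁻¹ ^ 3 := by positivity
  linarith

/-! ### The regularised absolute value of a `C²` function: derivatives and bounds -/

section Reg

variable {f : ℝ → ℝ} {ε : ℝ}

/-- `√(f² + ε²)` has derivative `f·f′/√(f²+ε²)`. -/
theorem hasDerivAt_reg (hε : 0 < ε) (hf : Differentiable ℝ f) (x : ℝ) :
    HasDerivAt (fun y => Real.sqrt (f y ^ 2 + ε ^ 2)) (f x * deriv f x / Real.sqrt (f x ^ 2 + ε ^ 2)) x := by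
  obtain ⟨hq, -, -, -, -⟩ := reg_facts (u := f x) hε
  have hpos : f x ^ 2 + ε ^ 2 ≠ 0 := by positivity
  have h1 : HasDerivAt (fun y => f y ^ 2 + ε ^ 2) (deriv f x * f x + f x * deriv f x) x :=
    (((hf x).hasDerivAt.mul (hf x).hasDerivAt).add_const (ε ^ 2)).congr_of_eventuallyEq
      (Eventually.of_forall fun y => show f y ^ 2 + ε ^ 2 = f y * f y + ε ^ 2 by ring)
  have h2 := h1.sqrt hpos
  refine h2.congr_deriv ?_
  field_simp
  ring

/-- `deriv √(f² + ε²) = f·f′/√(f²+ε²)`. -/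
theorem deriv_reg (hε : 0 < ε) (hf : Differentiable ℝ f) :
    deriv (fun y => Real.sqrt (f y ^ 2 + ε ^ 2)) = fun x => f x * deriv f x / Real.sqrt (f x ^ 2 + ε ^ 2) :=
  funext fun x => (hasDerivAt_reg hε hf x).deriv

/-- The second derivative of `√(f² + ε²)` for `f ∈ C²`: `(f′² + f·f″)/q − f²f′²/q³` (`q = √(f²+ε²)`), as a `HasDerivAt` statement for `deriv`. -/
theorem hasDerivAt_deriv_reg (hε : 0 < ε) (hf : ContDiff ℝ 2 f) (x : ℝ) :
    HasDerivAt (deriv fun y => Real.sqrt (f y ^ 2 + ε ^ 2))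
      ((deriv f x ^ 2 + f x * deriv (deriv f) x) * (Real.sqrt (f x ^ 2 + ε ^ 2))⁻¹
        - f x ^ 2 * deriv f x ^ 2 * (Real.sqrt (f x ^ 2 + ε ^ 2))⁻¹ ^ 3) x := by
  have hfd : Differentiable ℝ f := hf.differentiable (by norm_num)
  have hf1 : ContDiff ℝ 1 (deriv f) := by
    have h2 : ContDiff ℝ (1 + 1) f := by rwa [one_add_one_eq_two]
    exact h2.deriv'
  have hf'd : Differentiable ℝ (deriv f) := hf1.differentiable (by norm_num)
  obtain ⟨hq, hq2, -, -, -⟩ := reg_facts (u := f x) hε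
  rw [deriv_reg hε hfd]
  have hnum : HasDerivAt (fun y => f y * deriv f y) (deriv f x * deriv f x + f x * deriv (deriv f) x) x :=
    (hfd x).hasDerivAt.mul (hf'd x).hasDerivAt
  have h := hnum.div (hasDerivAt_reg hε hfd x) hq.ne'
  refine h.congr_deriv ?_
  field_simp

/-- Value bound: `|√(f²+ε²)| ≤ |f| + ε`. -/
theorem abs_reg_le (hε : 0 < ε) (x : ℝ) : |Real.sqrt (f x ^ 2 + ε ^ 2)| ≤ |f x| + ε := by
  obtain ⟨hq, -, -, -, hle⟩ := reg_facts (u := f x) hε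
  rw [abs_of_pos hq]; exact hle

/-- First-derivative bound: `|f·f′/q| ≤ |f′|`. -/
theorem abs_deriv_reg_le (hε : 0 < ε) (x : ℝ) :
    |f x * deriv f x / Real.sqrt (f x ^ 2 + ε ^ 2)| ≤ |deriv f x| := by
  obtain ⟨hq, -, hu, -, -⟩ := reg_facts (u := f x) hε
  rw [abs_div, abs_mul, abs_of_pos hq, div_le_iff₀ hq]
  nlinarith [abs_nonneg (deriv f x), abs_nonneg (f x)]

/-- The same bound in the `q⁻¹` spelling: `|f·g·q⁻¹| ≤ |g|` for any `g`. -/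
theorem abs_mul_mul_inv_reg_le (hε : 0 < ε) (x g : ℝ) :
    |f x * g * (Real.sqrt (f x ^ 2 + ε ^ 2))⁻¹| ≤ |g| := by
  obtain ⟨hq, -, hu, -, -⟩ := reg_facts (u := f x) hε
  rw [← div_eq_mul_inv, abs_div, abs_mul, abs_of_pos hq, div_le_iff₀ hq]
  nlinarith [abs_nonneg g, abs_nonneg (f x)]

/-- Second-derivative bound: `|(f′² + f·f″)/q − f²f′²/q³| ≤ 2f′²/ε + |f″|`. -/
theorem abs_deriv_deriv_reg_le (hε : 0 < ε) (x : ℝ) :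
    |(deriv f x ^ 2 + f x * deriv (deriv f) x) * (Real.sqrt (f x ^ 2 + ε ^ 2))⁻¹
        - f x ^ 2 * deriv f x ^ 2 * (Real.sqrt (f x ^ 2 + ε ^ 2))⁻¹ ^ 3| ≤
      2 * deriv f x ^ 2 / ε + |deriv (deriv f) x| := by
  obtain ⟨hq, hq2, hu, hεq, -⟩ := reg_facts (u := f x) hε
  set q := Real.sqrt (f x ^ 2 + ε ^ 2) with hqdef
  set r := q⁻¹ with hr
  have hr0 : 0 < r := inv_pos.2 hq
  have hqr : q * r = 1 := mul_inv_cancel₀ hq.ne'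
  have hrε : r ≤ ε⁻¹ := by rw [hr]; exact inv_anti₀ hε hεq
  have hrε' : r ≤ 1 / ε := by rwa [one_div]
  have hur : |f x| * r ≤ 1 := by
    calc |f x| * r ≤ q * r := mul_le_mul_of_nonneg_right hu hr0.le
      _ = 1 := hqr
  have hu2r2 : f x ^ 2 * r ^ 2 ≤ 1 := by
    have : f x ^ 2 * r ^ 2 = (|f x| * r) ^ 2 := by rw [mul_pow, sq_abs]
    rw [this]; exact pow_le_one₀ (by positivity) hur
  have t1 : |(deriv f x ^ 2 + f x * deriv (deriv f) x) * r| ≤ deriv f x ^ 2 / ε + |deriv (deriv f) x| := by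
    rw [abs_mul, abs_of_pos hr0]
    have ha : |deriv f x ^ 2 + f x * deriv (deriv f) x| ≤ deriv f x ^ 2 + |f x| * |deriv (deriv f) x| := by
      calc |deriv f x ^ 2 + f x * deriv (deriv f) x| ≤ |deriv f x ^ 2| + |f x * deriv (deriv f) x| := abs_add_le _ _
        _ = deriv f x ^ 2 + |f x| * |deriv (deriv f) x| := by rw [abs_of_nonneg (sq_nonneg _), abs_mul]
    calc |deriv f x ^ 2 + f x * deriv (deriv f) x| * r ≤ (deriv f x ^ 2 + |f x| * |deriv (deriv f) x|) * r :=
          mul_le_mul_of_nonneg_right ha hr0.le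
      _ = deriv f x ^ 2 * r + (|f x| * r) * |deriv (deriv f) x| := by ring
      _ ≤ deriv f x ^ 2 * (1 / ε) + 1 * |deriv (deriv f) x| :=
          add_le_add (mul_le_mul_of_nonneg_left hrε' (sq_nonneg _)) (mul_le_mul_of_nonneg_right hur (abs_nonneg _))
      _ = deriv f x ^ 2 / ε + |deriv (deriv f) x| := by ring
  have t2 : |f x ^ 2 * deriv f x ^ 2 * r ^ 3| ≤ deriv f x ^ 2 / ε := by
    rw [abs_of_nonneg (by positivity)]
    calc f x ^ 2 * deriv f x ^ 2 * r ^ 3 = (f x ^ 2 * r ^ 2) * (deriv f x ^ 2 * r) := by ring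
      _ ≤ 1 * (deriv f x ^ 2 * r) := mul_le_mul_of_nonneg_right hu2r2 (by positivity)
      _ ≤ 1 * (deriv f x ^ 2 * (1 / ε)) := by
          rw [one_mul, one_mul]; exact mul_le_mul_of_nonneg_left hrε' (sq_nonneg _)
      _ = deriv f x ^ 2 / ε := by ring
  calc |(deriv f x ^ 2 + f x * deriv (deriv f) x) * r - f x ^ 2 * deriv f x ^ 2 * r ^ 3|
      ≤ |(deriv f x ^ 2 + f x * deriv (deriv f) x) * r| + |f x ^ 2 * deriv f x ^ 2 * r ^ 3| := abs_sub _ _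
    _ ≤ (deriv f x ^ 2 / ε + |deriv (deriv f) x|) + deriv f x ^ 2 / ε := add_le_add t1 t2
    _ = 2 * deriv f x ^ 2 / ε + |deriv (deriv f) x| := by ring

/-- `√(f² + ε²) ∈ C²` for `f ∈ C²`. -/
theorem contDiff_reg (hε : 0 < ε) (hf : ContDiff ℝ 2 f) : ContDiff ℝ 2 fun y => Real.sqrt (f y ^ 2 + ε ^ 2) :=
  ((hf.pow 2).add contDiff_const).sqrt fun x => by positivity

end Reg

end Summit.NavierStokesRegularity.NavierStokesRegularity.Theorems.PoloidalWindowDoorLrcModEntireTwistingTHOscRegularisedAbs
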